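import Literature.MathematicalPhysics.QuantumFieldTheory.ConformalBootstrap3D.BlockExistence
import Literature.MathematicalPhysics.QuantumFieldTheory.ConformalBootstrap3D.MixedBlockCoefficientExistence
import Mathlib.Tactic
import HarnessLib

/-!
# Existence of the 3D block for unequal external dimensions: the Dolan–Osborn `(a,b)` series converges on the unit bidisk

Companion of `BlockExistence` (the `Δ₁₂ = Δ₃₄ = 0` channels) for the MIXED channels of the σ–ε system
(`⟨σεσε⟩`, `⟨εσσε⟩`: `a = -Δ₁₂/2`, `b = Δ₃₄/2` non-zero). pub-ising3d Limitation (a) "satisfiability of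
A2": this file PROVES that for every `Δ₁₂, Δ₃₄` and every `Δ` strictly above the 3D unitarity bound the
function `hrBlockAB Δ₁₂ Δ₃₄ Δ ℓ (z,z̄) = (z z̄)^{(Δ-ℓ)/2} Σ_{m,n} k^{ab}_{mn} z^m z̄^n`
(`k^{ab} = hrMonomialCoeffAB a b Δ ℓ`, the Dolan–Osborn array of `MixedBlockCoefficientExistence`)
satisfies the generic typed predicate `IsConformalBlock3DAbove Δ₁₂ Δ₃₄ Δ ℓ`
(`isConformalBlock3DAbove_hrBlockAB`), hence `IsConformalBlock3D` at every regular point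
(`isConformalBlock3D_hrBlockAB`, `exists_isConformalBlock3D_ab`), and is the unique such function there
(`IsConformalBlock3DAbove.eq_hrBlockAB`); `hrBlockAB 0 0 = hrBlock` (`hrBlockAB_zero_zero`).

The only new analytic input is absolute convergence of the `(a,b)` double series on the unit bidisk
(`summable_abs_hrMonomialCoeffAB_mul_pow`, `isDoublePowerSeriesOn_hrSeriesAB`); the Casimir equation then
follows from `hrMonomialCoeffAB_satisfies` and `casimirEq3D_of_satisfiesCoeffCasimir` (`BlockExistence`,
valid for all external dimensions). Convergence: the absolute level sums
`b_n = Σ_j |A_{n,j}(a,b)|` grow at most polynomially (`hrAbsLevelSumAB_le_ascWeight`: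
`b_n ≤ C (n+1)(n+2)⋯(n+K)` with `K = 40⌈max(|a|,|b|)⌉ + 24`). Mechanism — a comparison, no new
certificate: for `|a|, |b| ≤ c` the Dolan–Osborn weights are dominated by the Hogervorst–Rychkov weights at
the shifted dimension `Δ'' = Δ + 2c + 1` (`abs_hrGammaPlusAB_le_shift`, `abs_hrGammaMinusAB_le_shift`; the
second uses `E - j - 1 ≥ Δ - ℓ - 1 ≥ -1/2` on the descendant range), the pivots at `Δ''` exceed those at
`Δ` by exactly `2(n+1)(2c+1)` (`casimirPivot3D_add`), which beyond the threshold `(Δ''+ℓ+2)²` is a relative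
excess `≤ 4(2c+1)/(n+1)` (`casimirPivot3D_succ_zero_ge`: the smallest pivot is `≥ (n+1)²/2`); with the
transfer inequality of `BlockExistence` at `Δ''` the column-wise weight of the `(a,b)` recursion is
`≤ (1 + 4(2c+1)/(n+1))(1 + 4/(n+1)) ≤ 1 + (40c+24)/(n+1)` (`abTransferWeight_le`), and the generic
column-wise resummation `sum_transfer_eq` gives `b_{n+1} ≤ (1 + (40c+24)/(n+1)) b_n`
(`hrAbsLevelSumAB_succ_le`). The comparison weights `q_K(n) = (n+1)⋯(n+K)` satisfy
`(1 + K/(n+1)) q_K(n) = q_K(n+1)` exactly (`ascWeight_succ`), `q_K(m+n) ≤ q_K(m) q_K(n)`,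
`q_K(n) ≤ K!(n+1)^K`, so `|k^{ab}_{mn}| ≤ b_{m+n-ℓ}/λ_ℓ ≤ C' q_K(m) q_K(n)` (`abs_hrMonomialCoeffAB_le`, via
`e_{N,j} ≤ 1`, `legendreLam_le_one`) is dominated by a summable product family.

What is NOT here: the limit clause for `Δ₁₂ Δ₃₄ ≠ 0` — at the unitarity bound `Δ = ℓ+1` the unequal
block has a genuine pole (`MixedBlockCoefficients.hrCoeffAB_one_pred`) and NO limit exists, so A2 rightly
forces the absence of spin-`ℓ` currents in `σ × ε` (Ward identity); at accidental degeneracies above the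
bound the limit exists (same proof as `BlockExistenceLimit`) but is not formalised here. No new
hypothesis-style fact is introduced.

Sources: F. A. Dolan, H. Osborn, Nucl. Phys. B 678 (2004) 491 [hep-th/0309180], §3 eqs. (3.9)–(3.12)
(the `(a,b)` recursion); M. Hogervorst, S. Rychkov, Phys. Rev. D 87 (2013) 106004 [arXiv:1303.1111],
§2.2 eq. (2.27); the growth/comparison argument is ours (elementary). Mathlib: `Summable.mul_of_nonneg`,
`summable_pow_mul_geometric_of_norm_lt_one`, `Finset.prod_range_succ'`.
-/

namespace Literature.MathematicalPhysics.QuantumFieldTheory.ConformalBootstrap3D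

open Finset Set Filter Topology

/-! ### 1. A generic column-wise transfer identity -/

/-- **Column-wise resummation of a two-term triangular recursion.** For weights `u, v` with `v 0 = 0`,
pivots `P`, and a row `B` supported on `j ≤ L`:
`Σ_{j ≤ L+1} (u(j-1)B(j-1) + v(j+1)B(j+1))/P(j) = Σ_{j ≤ L} (u j/P(j+1) + v j/P(j-1)) B j`
(the Hogervorst–Rychkov / Dolan–Osborn recursion read "parent → children"). [folklore] -/
theorem sum_transfer_eq (u v P B : ℕ → ℝ) (L : ℕ) (hv : v 0 = 0) (hB1 : B (L + 1) = 0)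
    (hB2 : B (L + 1 + 1) = 0) :
    ∑ j ∈ range (L + 1 + 1),
        ((if j = 0 then (0 : ℝ) else u (j - 1) * B (j - 1)) + v (j + 1) * B (j + 1)) / P j
      = ∑ j ∈ range (L + 1), (u j / P (j + 1) + v j / P (j - 1)) * B j := by
  simp_rw [add_div, Finset.sum_add_distrib]
  rw [Finset.sum_range_succ' (fun j => (if j = 0 then (0 : ℝ) else u (j - 1) * B (j - 1)) / P j)]
  simp only [Nat.add_one_ne_zero, if_false, Nat.add_sub_cancel, if_true, zero_div, add_zero]
  rw [Finset.sum_range_succ (fun j => v (j + 1) * B (j + 1) / P j),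
    Finset.sum_range_succ (fun j => v (j + 1) * B (j + 1) / P j), hB1, hB2]
  simp only [mul_zero, zero_div, add_zero]
  simp_rw [add_mul, Finset.sum_add_distrib]
  congr 1
  · exact Finset.sum_congr rfl fun j _ => by ring
  · rw [Finset.sum_range_succ' (fun j => v j / P (j - 1) * B j)]
    simp only [hv, zero_div, zero_mul, add_zero, Nat.add_sub_cancel]
    exact Finset.sum_congr rfl fun j _ => by ring

/-! ### 2. Comparison with the `a = b = 0` transfer weight at a shifted dimension

No new certificate is needed for the `(a,b)` recursion: for `|a|, |b| ≤ c` the Dolan–Osborn weights are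
dominated by the Hogervorst–Rychkov weights at the SHIFTED dimension `Δ'' = Δ + 2c + 1`
(`|γ⁺_{E,j}(a,b)| ≤ γ⁺_{E+2c+1,j}`, `|γ⁻_{E,j}(a,b)| ≤ γ⁻_{E+2c+1,j}`), the pivots at `Δ''` exceed those
at `Δ` by exactly `2(n+1)(2c+1)`, and beyond the threshold this excess is a relative `O(1/n)`:
`P(Δ'')/P(Δ) ≤ 1 + 4(2c+1)/(n+1)`. Hence the `(a,b)` transfer weight is at most
`(1 + 4(2c+1)/(n+1))(1 + 4/(n+1)) ≤ 1 + (40c+24)/(n+1)`, using `hrTransferWeight_le` at `Δ''`. -/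

/-- Shifting `Δ` shifts every pivot by `2nδ`. [cite: HogervorstRychkov2013, §2.2 eq. (2.27)] -/
theorem casimirPivot3D_add (Δ δ : ℝ) (ℓ n j : ℕ) :
    casimirPivot3D (Δ + δ) ℓ n j = casimirPivot3D Δ ℓ n j + 2 * (n : ℝ) * δ := by
  unfold casimirPivot3D; ring

/-- Pivots increase with the spin index: `P(n, j) ≥ P(n, 0)`. [cite: HogervorstRychkov2013, §2.2 eq. (2.27)] -/
theorem casimirPivot3D_zero_le (Δ : ℝ) (ℓ n j : ℕ) :
    casimirPivot3D Δ ℓ n 0 ≤ casimirPivot3D Δ ℓ n j := by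
  unfold casimirPivot3D
  have hj : (0 : ℝ) ≤ (j : ℝ) := Nat.cast_nonneg j
  push_cast
  nlinarith

/-- The `(a,b)` threshold: the `a = b = 0` threshold at the shifted dimension `Δ + 2c + 1`.
[folklore] -/
noncomputable def abThreshold (c Δ : ℝ) (ℓ : ℕ) : ℝ := hrThreshold (Δ + (2 * c + 1)) ℓ

/-- Beyond the threshold, `n ≥ 2ℓ + 6`. [folklore] -/
theorem abThreshold_large {c Δ : ℝ} {ℓ n : ℕ} (hc : 0 ≤ c) (hΔ : 0 ≤ Δ) (hn : abThreshold c Δ ℓ ≤ n) :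
    2 * (ℓ : ℝ) + 6 ≤ n := by
  unfold abThreshold hrThreshold at hn
  have hL : (0 : ℝ) ≤ (ℓ : ℝ) := Nat.cast_nonneg ℓ
  have h1 : (ℓ : ℝ) + 3 ≤ Δ + (2 * c + 1) + ℓ + 2 := by linarith
  have h2 : ((ℓ : ℝ) + 3) ^ 2 ≤ (Δ + (2 * c + 1) + ℓ + 2) ^ 2 :=
    pow_le_pow_left₀ (by positivity) h1 2
  nlinarith

/-- Beyond the threshold the spin-`0` pivot of the next level is at least `(n+1)²/2`.
[cite: HogervorstRychkov2013, §2.2 eq. (2.27)] -/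
theorem casimirPivot3D_succ_zero_ge {Δ : ℝ} {ℓ n : ℕ} (hΔ : 0 ≤ Δ) (hn : 2 * (ℓ : ℝ) + 6 ≤ n) :
    ((n : ℝ) + 1) ^ 2 / 2 ≤ casimirPivot3D Δ ℓ (n + 1) 0 := by
  unfold casimirPivot3D
  push_cast
  have hL : (0 : ℝ) ≤ (ℓ : ℝ) := Nat.cast_nonneg ℓ
  have hn0 : (0 : ℝ) ≤ (n : ℝ) := Nat.cast_nonneg n
  nlinarith [mul_le_mul hn hn (by positivity) hn0, mul_nonneg hn0 hΔ]

/-- Elementary: `x/P ≤ (1 + d/P₀) · x/(P + d)` for `x, d ≥ 0`, `0 < P₀ ≤ P`. [folklore] -/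
theorem div_le_shift_mul_div {x P d P₀ : ℝ} (hx : 0 ≤ x) (hP₀ : 0 < P₀) (hP : P₀ ≤ P)
    (hd : 0 ≤ d) : x / P ≤ (1 + d / P₀) * (x / (P + d)) := by
  have hPpos : 0 < P := lt_of_lt_of_le hP₀ hP
  have hPd : 0 < P + d := by linarith
  rw [div_le_iff₀ hPpos]
  have h1 : (1 + d / P₀) * (x / (P + d)) * P = x * ((P + d * (P / P₀)) / (P + d)) := by
    field_simp
  rw [h1]
  have h2 : 1 ≤ (P + d * (P / P₀)) / (P + d) := by
    rw [le_div_iff₀ hPd]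
    have : 1 ≤ P / P₀ := (one_le_div hP₀).mpr hP
    nlinarith
  nlinarith

/-! ### 3. Domination of the Dolan–Osborn weights by shifted Hogervorst–Rychkov weights -/

/-- `|γ⁺_{E,j}(a,b)| ≤ γ⁺_{E+2c+1,j}` for `E ≥ 0`, `|a|, |b| ≤ c`.
[cite: DolanOsborn2004, §3 eqs. (3.9), (3.11)] -/
theorem abs_hrGammaPlusAB_le_shift {a b c E : ℝ} (hE : 0 ≤ E) (ha : |a| ≤ c) (hb : |b| ≤ c)
    (j : ℕ) : |hrGammaPlusAB a b E j| ≤ hrGammaPlus (E + (2 * c + 1)) j := by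
  unfold hrGammaPlusAB hrGammaPlus
  have hj : (0 : ℝ) ≤ (j : ℝ) := Nat.cast_nonneg j
  have h2j : (0 : ℝ) < 2 * (j : ℝ) + 1 := by positivity
  have hc : 0 ≤ c := (abs_nonneg a).trans ha
  have ha' := abs_le.mp ha
  have hb' := abs_le.mp hb
  rw [abs_div, abs_of_pos h2j, abs_mul, abs_of_nonneg (by positivity : (0 : ℝ) ≤ (j : ℝ) + 1)]
  refine div_le_div_of_nonneg_right ?_ h2j.le
  refine mul_le_mul_of_nonneg_right ?_ (by positivity)
  have h1 : |E + j + 2 * a| ≤ E + (2 * c + 1) + j := abs_le.mpr ⟨by linarith, by linarith⟩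
  have h2 : |E + j + 2 * b| ≤ E + (2 * c + 1) + j := abs_le.mpr ⟨by linarith, by linarith⟩
  rw [abs_mul, sq]
  exact mul_le_mul h1 h2 (abs_nonneg _) (by linarith [abs_nonneg (E + j + 2 * a)])

/-- `|γ⁻_{E,j}(a,b)| ≤ γ⁻_{E+2c+1,j}` for `E - j - 1 ≥ -1/2`, `|a|, |b| ≤ c` (uses `|y| ≤ y + 1` for
`y ≥ -1/2`). [cite: DolanOsborn2004, §3 eqs. (3.9), (3.11)] -/
theorem abs_hrGammaMinusAB_le_shift {a b c E : ℝ} {j : ℕ} (hE : -1 / 2 ≤ E - j - 1) (ha : |a| ≤ c)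
    (hb : |b| ≤ c) : |hrGammaMinusAB a b E j| ≤ hrGammaMinus (E + (2 * c + 1)) j := by
  unfold hrGammaMinusAB hrGammaMinus
  have hj : (0 : ℝ) ≤ (j : ℝ) := Nat.cast_nonneg j
  have h2j : (0 : ℝ) < 2 * (j : ℝ) + 1 := by positivity
  have ha' := abs_le.mp ha
  have hb' := abs_le.mp hb
  rw [abs_div, abs_of_pos h2j, abs_mul, abs_of_nonneg hj]
  refine div_le_div_of_nonneg_right ?_ h2j.le
  refine mul_le_mul_of_nonneg_right ?_ hj
  have h1 : |E - j - 1 + 2 * a| ≤ E + (2 * c + 1) - j - 1 := abs_le.mpr ⟨by linarith, by linarith⟩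
  have h2 : |E - j - 1 + 2 * b| ≤ E + (2 * c + 1) - j - 1 := abs_le.mpr ⟨by linarith, by linarith⟩
  rw [abs_mul, sq]
  exact mul_le_mul h1 h2 (abs_nonneg _) (by linarith [abs_nonneg (E - j - 1 + 2 * a)])

/-- **Transfer inequality for the `(a,b)` recursion.** For `Δ` above the unitarity bound,
`|a|, |b| ≤ c`, `n ≥ (Δ+2c+1+ℓ+2)²` and `j ≤ ℓ + n`:
`|γ⁺_{Δ+n,j}(a,b)|/P₊ + |γ⁻_{Δ+n,j}(a,b)|/P₋ ≤ 1 + (40c+24)/(n+1)`.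
[cite: DolanOsborn2004, §3 eqs. (3.9)–(3.12)] -/
theorem abTransferWeight_le {a b c Δ : ℝ} {ℓ n j : ℕ} (hΔ : unitarityBound3D ℓ < Δ)
    (ha : |a| ≤ c) (hb : |b| ≤ c) (hn : abThreshold c Δ ℓ ≤ n) (hj : j ≤ ℓ + n) :
    |hrGammaPlusAB a b (Δ + n) j| / casimirPivot3D Δ ℓ (n + 1) (j + 1)
      + |hrGammaMinusAB a b (Δ + n) j| / casimirPivot3D Δ ℓ (n + 1) (j - 1)
      ≤ 1 + (40 * c + 24) / ((n : ℝ) + 1) := by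
  have hc : 0 ≤ c := (abs_nonneg a).trans ha
  have hhalf := one_half_lt_of_unitarityBound3D_lt hΔ
  have hΔ0 : 0 ≤ Δ := by linarith
  set δ : ℝ := 2 * c + 1 with hδ
  have hδ0 : 0 ≤ δ := by positivity
  have hΔ'' : 0 ≤ Δ + δ := by positivity
  have hn'' : hrThreshold (Δ + δ) ℓ ≤ n := hn
  have hn1 : (0 : ℝ) < (n : ℝ) + 1 := by positivity
  -- pivots at `Δ` beyond the (larger) threshold
  have hn0 : hrThreshold Δ ℓ ≤ n := by
    refine le_trans ?_ hn''
    unfold hrThreshold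
    have hL : (0 : ℝ) ≤ (ℓ : ℝ) := Nat.cast_nonneg ℓ
    nlinarith
  have hP : ∀ j' : ℕ, 0 < casimirPivot3D Δ ℓ (n + 1) j' := casimirPivot3D_succ_pos hΔ0 hn0
  have hP'' : ∀ j' : ℕ, 0 < casimirPivot3D (Δ + δ) ℓ (n + 1) j' := casimirPivot3D_succ_pos hΔ'' hn''
  have hlarge := abThreshold_large hc hΔ0 hn
  have hP0 := casimirPivot3D_succ_zero_ge (ℓ := ℓ) hΔ0 hlarge
  have hP0pos : 0 < casimirPivot3D Δ ℓ (n + 1) 0 := hP 0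
  -- `E - j - 1 ≥ Δ - ℓ - 1 ≥ -1/2`
  have hE : -1 / 2 ≤ Δ + n - j - 1 := by
    have hj' : (j : ℝ) ≤ (ℓ : ℝ) + (n : ℝ) := by exact_mod_cast hj
    have hb' : (ℓ : ℝ) + 1 / 2 ≤ Δ := by
      rcases Nat.eq_zero_or_pos ℓ with h0 | hpos
      · subst h0; simp; linarith
      · have : unitarityBound3D ℓ = (ℓ : ℝ) + 1 := by
          unfold unitarityBound3D; rw [if_neg (by omega)]
        rw [this] at hΔ; linarith
    linarith
  -- the excess of the shifted pivots
  set d : ℝ := 2 * ((n + 1 : ℕ) : ℝ) * δ with hd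
  have hd0 : 0 ≤ d := by positivity
  have hshift : ∀ j' : ℕ, casimirPivot3D (Δ + δ) ℓ (n + 1) j' = casimirPivot3D Δ ℓ (n + 1) j' + d :=
    fun j' => casimirPivot3D_add Δ δ ℓ (n + 1) j'
  -- domination of the two terms
  have hplus : |hrGammaPlusAB a b (Δ + n) j| / casimirPivot3D Δ ℓ (n + 1) (j + 1) ≤
      (1 + d / casimirPivot3D Δ ℓ (n + 1) 0) *
        (hrGammaPlus (Δ + δ + n) j / casimirPivot3D (Δ + δ) ℓ (n + 1) (j + 1)) := by
    have h1 : |hrGammaPlusAB a b (Δ + n) j| ≤ hrGammaPlus (Δ + δ + n) j := by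
      have := abs_hrGammaPlusAB_le_shift (E := Δ + n) (by positivity) ha hb j
      rwa [show Δ + ↑n + (2 * c + 1) = Δ + δ + n by rw [hδ]; ring] at this
    refine (div_le_div_of_nonneg_right h1 (hP _).le).trans ?_
    rw [hshift]
    exact div_le_shift_mul_div (hrGammaPlus_nonneg _ _) hP0pos (casimirPivot3D_zero_le Δ ℓ _ _) hd0
  have hminus : |hrGammaMinusAB a b (Δ + n) j| / casimirPivot3D Δ ℓ (n + 1) (j - 1) ≤
      (1 + d / casimirPivot3D Δ ℓ (n + 1) 0) *
        (hrGammaMinus (Δ + δ + n) j / casimirPivot3D (Δ + δ) ℓ (n + 1) (j - 1)) := by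
    have h1 : |hrGammaMinusAB a b (Δ + n) j| ≤ hrGammaMinus (Δ + δ + n) j := by
      have := abs_hrGammaMinusAB_le_shift (E := Δ + n) hE ha hb
      rwa [show Δ + ↑n + (2 * c + 1) = Δ + δ + n by rw [hδ]; ring] at this
    refine (div_le_div_of_nonneg_right h1 (hP _).le).trans ?_
    rw [hshift]
    exact div_le_shift_mul_div (hrGammaMinus_nonneg _ _) hP0pos (casimirPivot3D_zero_le Δ ℓ _ _) hd0
  -- the shifted weight is the `a = b = 0` transfer weight at `Δ + δ`
  have hW : hrGammaPlus (Δ + δ + n) j / casimirPivot3D (Δ + δ) ℓ (n + 1) (j + 1)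
      + hrGammaMinus (Δ + δ + n) j / casimirPivot3D (Δ + δ) ℓ (n + 1) (j - 1) ≤ 1 + 4 / ((n : ℝ) + 1) :=
    hrTransferWeight_le hΔ'' hn'' j
  -- the relative excess is `≤ 4(2c+1)/(n+1)`
  have hρ : d / casimirPivot3D Δ ℓ (n + 1) 0 ≤ 4 * δ / ((n : ℝ) + 1) := by
    rw [div_le_div_iff₀ hP0pos hn1, hd]
    push_cast
    nlinarith [hP0, hδ0]
  have hρ0 : 0 ≤ 1 + d / casimirPivot3D Δ ℓ (n + 1) 0 := by positivity
  calc |hrGammaPlusAB a b (Δ + n) j| / casimirPivot3D Δ ℓ (n + 1) (j + 1)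
        + |hrGammaMinusAB a b (Δ + n) j| / casimirPivot3D Δ ℓ (n + 1) (j - 1)
      ≤ (1 + d / casimirPivot3D Δ ℓ (n + 1) 0) *
          (hrGammaPlus (Δ + δ + n) j / casimirPivot3D (Δ + δ) ℓ (n + 1) (j + 1)
            + hrGammaMinus (Δ + δ + n) j / casimirPivot3D (Δ + δ) ℓ (n + 1) (j - 1)) := by
        rw [mul_add]; exact add_le_add hplus hminus
    _ ≤ (1 + 4 * δ / ((n : ℝ) + 1)) * (1 + 4 / ((n : ℝ) + 1)) :=
        mul_le_mul (by linarith) hW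
          (add_nonneg (div_nonneg (hrGammaPlus_nonneg _ _) (hP'' _).le)
            (div_nonneg (hrGammaMinus_nonneg _ _) (hP'' _).le)) (by positivity)
    _ ≤ 1 + (40 * c + 24) / ((n : ℝ) + 1) := by
        rw [hδ]
        have hn1' : (1 : ℝ) ≤ (n : ℝ) + 1 := by linarith [Nat.cast_nonneg (α := ℝ) n]
        rw [show (1 + 4 * (2 * c + 1) / ((n : ℝ) + 1)) * (1 + 4 / ((n : ℝ) + 1))
            = 1 + (8 * c + 8) / ((n : ℝ) + 1) + 16 * (2 * c + 1) / ((n : ℝ) + 1) ^ 2 by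
          field_simp; ring]
        have h3 : 16 * (2 * c + 1) / ((n : ℝ) + 1) ^ 2 ≤ 16 * (2 * c + 1) / ((n : ℝ) + 1) := by
          apply div_le_div_of_nonneg_left (by positivity) hn1
          nlinarith
        have h4 : (8 * c + 8) / ((n : ℝ) + 1) + 16 * (2 * c + 1) / ((n : ℝ) + 1)
            = (40 * c + 24) / ((n : ℝ) + 1) := by
          field_simp; ring
        linarith

/-! ### 4. Polynomial growth of the absolute level sums -/

/-- The absolute level sums `b_n(a,b;Δ,ℓ) = Σ_{j ≤ ℓ+n} |A_{n,j}(a,b)|`. [cite: DolanOsborn2004, §3 eq. (3.10)] -/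
noncomputable def hrAbsLevelSumAB (a b Δ : ℝ) (ℓ n : ℕ) : ℝ :=
  ∑ j ∈ range (ℓ + n + 1), |hrCoeffAB a b Δ ℓ n j|

/-- `b_n ≥ 0`. [folklore] -/
theorem hrAbsLevelSumAB_nonneg (a b Δ : ℝ) (ℓ n : ℕ) : 0 ≤ hrAbsLevelSumAB a b Δ ℓ n :=
  Finset.sum_nonneg fun _ _ => abs_nonneg _

/-- **Growth step for the `(a,b)` recursion**: above the unitarity bound, for `|a|,|b| ≤ c` and
`n ≥ (Δ+2c+1+ℓ+2)²`, `b_{n+1} ≤ (1 + (40c+24)/(n+1)) b_n`. [cite: DolanOsborn2004, §3 eqs. (3.9)–(3.12)] -/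
theorem hrAbsLevelSumAB_succ_le {a b c Δ : ℝ} {ℓ n : ℕ} (hΔ : unitarityBound3D ℓ < Δ)
    (ha : |a| ≤ c) (hb : |b| ≤ c) (hn : abThreshold c Δ ℓ ≤ n) :
    hrAbsLevelSumAB a b Δ ℓ (n + 1) ≤ (1 + (40 * c + 24) / ((n : ℝ) + 1)) * hrAbsLevelSumAB a b Δ ℓ n := by
  have hc : 0 ≤ c := (abs_nonneg a).trans ha
  have hhalf := one_half_lt_of_unitarityBound3D_lt hΔ
  have hΔ0 : 0 ≤ Δ := by linarith
  have hn0 : hrThreshold Δ ℓ ≤ n := by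
    refine le_trans ?_ hn
    unfold abThreshold hrThreshold
    have hL : (0 : ℝ) ≤ (ℓ : ℝ) := Nat.cast_nonneg ℓ
    nlinarith
  have hP : ∀ j' : ℕ, 0 < casimirPivot3D Δ ℓ (n + 1) j' := casimirPivot3D_succ_pos hΔ0 hn0
  unfold hrAbsLevelSumAB
  have hN : ℓ + (n + 1) + 1 = (ℓ + n) + 1 + 1 := by omega
  rw [hN]
  -- termwise: `|A_{n+1,j}| ≤ (|γ⁺||A_{n,j-1}| + |γ⁻||A_{n,j+1}|)/P_j`
  have hterm : ∀ j ∈ range (ℓ + n + 1 + 1), |hrCoeffAB a b Δ ℓ (n + 1) j| ≤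
      ((if j = 0 then (0 : ℝ) else |hrGammaPlusAB a b (Δ + n) (j - 1)| * |hrCoeffAB a b Δ ℓ n (j - 1)|)
        + |hrGammaMinusAB a b (Δ + n) (j + 1)| * |hrCoeffAB a b Δ ℓ n (j + 1)|) /
        casimirPivot3D Δ ℓ (n + 1) j := by
    intro j _
    rw [hrCoeffAB_succ, abs_div, abs_of_pos (hP j)]
    refine div_le_div_of_nonneg_right ?_ (hP j).le
    refine (abs_add_le _ _).trans (add_le_add ?_ (le_of_eq (abs_mul _ _)))
    split_ifs
    · simp
    · exact le_of_eq (abs_mul _ _)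
  refine (Finset.sum_le_sum hterm).trans ?_
  rw [sum_transfer_eq (fun j => |hrGammaPlusAB a b (Δ + n) j|) (fun j => |hrGammaMinusAB a b (Δ + n) j|)
    (fun j => casimirPivot3D Δ ℓ (n + 1) j) (fun j => |hrCoeffAB a b Δ ℓ n j|) (ℓ + n)
    (by simp [hrGammaMinusAB]) (by rw [hrCoeffAB_eq_zero_of_lt a b Δ (by omega), abs_zero])
    (by rw [hrCoeffAB_eq_zero_of_lt a b Δ (by omega), abs_zero]), Finset.mul_sum]
  refine Finset.sum_le_sum fun j hj => ?_
  exact mul_le_mul_of_nonneg_right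
    (abTransferWeight_le hΔ ha hb hn (by simpa [Nat.lt_succ_iff] using mem_range.mp hj))
    (abs_nonneg _)

/-! ### 6. The ascending-factorial comparison weights -/

/-- `q_K(n) = (n+1)(n+2)⋯(n+K)`; `(1 + K/(n+1)) q_K(n) = q_K(n+1)` exactly. [folklore] -/
noncomputable def ascWeight (K n : ℕ) : ℝ := ∏ i ∈ range K, ((n : ℝ) + (i : ℝ) + 1)

/-- `q_K(n) ≥ 1`. [folklore] -/
theorem one_le_ascWeight (K n : ℕ) : 1 ≤ ascWeight K n := by
  unfold ascWeight
  induction K with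
  | zero => simp
  | succ K ih =>
    rw [Finset.prod_range_succ]
    have h1 : (1 : ℝ) ≤ (n : ℝ) + (K : ℝ) + 1 := by
      have := Nat.cast_nonneg (α := ℝ) n; have := Nat.cast_nonneg (α := ℝ) K; linarith
    exact one_le_mul_of_one_le_of_one_le ih h1

/-- `q_K(n) > 0`. [folklore] -/
theorem ascWeight_pos (K n : ℕ) : 0 < ascWeight K n := lt_of_lt_of_le one_pos (one_le_ascWeight K n)

/-- The exact step `(n+1+K) q_K(n) = (n+1) q_K(n+1)`. [folklore] -/
theorem ascWeight_step (K n : ℕ) :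
    ((n : ℝ) + 1 + K) * ascWeight K n = ((n : ℝ) + 1) * ascWeight K (n + 1) := by
  unfold ascWeight
  have h1 := Finset.prod_range_succ (fun i => ((n : ℝ) + (i : ℝ) + 1)) K
  have h2 := Finset.prod_range_succ' (fun i => ((n : ℝ) + (i : ℝ) + 1)) K
  push_cast at h1 h2 ⊢
  have h3 : ∏ x ∈ range K, ((n : ℝ) + 1 + (x : ℝ) + 1) =
      ∏ x ∈ range K, ((n : ℝ) + ((x : ℝ) + 1) + 1) :=
    Finset.prod_congr rfl fun i _ => by ring
  rw [h3]
  linear_combination h2 - h1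

/-- `(1 + K/(n+1)) q_K(n) = q_K(n+1)`. [folklore] -/
theorem ascWeight_succ (K n : ℕ) :
    (1 + (K : ℝ) / ((n : ℝ) + 1)) * ascWeight K n = ascWeight K (n + 1) := by
  have hn1 : (n : ℝ) + 1 ≠ 0 := by positivity
  have h := ascWeight_step K n
  field_simp
  linear_combination h

/-- `q_K` is monotone. [folklore] -/
theorem ascWeight_mono (K : ℕ) {m n : ℕ} (h : m ≤ n) : ascWeight K m ≤ ascWeight K n := by
  unfold ascWeight
  have hmn : (m : ℝ) ≤ (n : ℝ) := by exact_mod_cast h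
  exact Finset.prod_le_prod (fun i _ => by positivity) (fun i _ => by linarith)

/-- `q_K(m+n) ≤ q_K(m) q_K(n)`. [folklore] -/
theorem ascWeight_add_le (K m n : ℕ) : ascWeight K (m + n) ≤ ascWeight K m * ascWeight K n := by
  unfold ascWeight
  rw [← Finset.prod_mul_distrib]
  refine Finset.prod_le_prod (fun i _ => by positivity) (fun i _ => ?_)
  have hm : (0 : ℝ) ≤ (m : ℝ) := Nat.cast_nonneg m
  have hn : (0 : ℝ) ≤ (n : ℝ) := Nat.cast_nonneg n
  have hi : (0 : ℝ) ≤ (i : ℝ) := Nat.cast_nonneg i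
  push_cast
  nlinarith [mul_nonneg hm hn, mul_nonneg hm hi, mul_nonneg hn hi, mul_nonneg hi hi]

/-- `q_K(n) ≤ K! (n+1)^K`. [folklore] -/
theorem ascWeight_le_factorial_mul_pow (K n : ℕ) :
    ascWeight K n ≤ (K.factorial : ℝ) * ((n : ℝ) + 1) ^ K := by
  unfold ascWeight
  induction K with
  | zero => simp
  | succ K ih =>
    rw [Finset.prod_range_succ, Nat.factorial_succ, pow_succ]
    push_cast
    have hn : (0 : ℝ) ≤ (n : ℝ) := Nat.cast_nonneg n
    have hK : (0 : ℝ) ≤ (K : ℝ) := Nat.cast_nonneg K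
    have hfac : (n : ℝ) + K + 1 ≤ ((K : ℝ) + 1) * ((n : ℝ) + 1) := by nlinarith
    have hprod : 0 ≤ ∏ i ∈ range K, ((n : ℝ) + (i : ℝ) + 1) :=
      Finset.prod_nonneg fun i _ => by positivity
    calc (∏ i ∈ range K, ((n : ℝ) + (i : ℝ) + 1)) * ((n : ℝ) + K + 1)
        ≤ ((K.factorial : ℝ) * ((n : ℝ) + 1) ^ K) * (((K : ℝ) + 1) * ((n : ℝ) + 1)) :=
          mul_le_mul ih hfac (by positivity) (by positivity)
      _ = ((K : ℝ) + 1) * (K.factorial : ℝ) * (((n : ℝ) + 1) ^ K * ((n : ℝ) + 1)) := by ring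

/-- `Σ_n q_K(n) t^n` converges for `0 ≤ t < 1`. [folklore] -/
theorem summable_ascWeight_mul_pow (K : ℕ) {t : ℝ} (ht0 : 0 ≤ t) (ht1 : t < 1) :
    Summable fun n : ℕ => ascWeight K n * t ^ n := by
  have ht : ‖t‖ < 1 := by rwa [Real.norm_eq_abs, abs_of_nonneg ht0]
  -- `Σ (n+1)^K t^n` converges: expand `(n+1)^K` binomially
  have hpoly : Summable fun n : ℕ => ((n : ℝ) + 1) ^ K * t ^ n := by
    have h : ∀ n : ℕ, ((n : ℝ) + 1) ^ K * t ^ n =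
        ∑ k ∈ range (K + 1), ((K.choose k : ℕ) : ℝ) * ((n : ℝ) ^ k * t ^ n) := by
      intro n
      rw [add_pow, Finset.sum_mul]
      exact Finset.sum_congr rfl fun k _ => by rw [one_pow, mul_one]; ring
    simp_rw [h]
    exact summable_sum fun k _ => (summable_pow_mul_geometric_of_norm_lt_one k ht).mul_left _
  refine Summable.of_nonneg_of_le (fun n => mul_nonneg (ascWeight_pos K n).le (pow_nonneg ht0 _))
    (fun n => ?_) (hpoly.mul_left (K.factorial : ℝ))
  calc ascWeight K n * t ^ n ≤ ((K.factorial : ℝ) * ((n : ℝ) + 1) ^ K) * t ^ n :=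
        mul_le_mul_of_nonneg_right (ascWeight_le_factorial_mul_pow K n) (pow_nonneg ht0 _)
    _ = (K.factorial : ℝ) * (((n : ℝ) + 1) ^ K * t ^ n) := by ring

/-- **Polynomial growth of the absolute level sums**: above the unitarity bound there are a natural
`K` (any `K ≥ 40 max(|a|,|b|) + 24`) and `C ≥ 0` with `Σ_j |A_{n,j}(a,b)| ≤ C q_K(n)` for every `n`.
[cite: DolanOsborn2004, §3 eqs. (3.9)–(3.12)] -/
theorem hrAbsLevelSumAB_le_ascWeight {a b Δ : ℝ} {ℓ : ℕ} (hΔ : unitarityBound3D ℓ < Δ) :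
    ∃ (K : ℕ) (C : ℝ), 0 ≤ C ∧ ∀ n : ℕ, hrAbsLevelSumAB a b Δ ℓ n ≤ C * ascWeight K n := by
  set c := max |a| |b| with hc
  have ha : |a| ≤ c := le_max_left _ _
  have hb : |b| ≤ c := le_max_right _ _
  have hc0 : 0 ≤ c := (abs_nonneg a).trans ha
  set κ := ⌈c⌉₊ with hκ
  set K : ℕ := 40 * κ + 24 with hK
  have hKc : 40 * c + 24 ≤ (K : ℝ) := by
    have : c ≤ (κ : ℝ) := Nat.le_ceil c
    rw [hK]; push_cast; linarith
  set N₁ := ⌈abThreshold c Δ ℓ⌉₊ with hN₁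
  have hthr : ∀ n : ℕ, N₁ ≤ n → abThreshold c Δ ℓ ≤ n := fun n hn => Nat.ceil_le.mp hn
  set C := ∑ k ∈ range (N₁ + 1), hrAbsLevelSumAB a b Δ ℓ k with hC
  have hC0 : 0 ≤ C := Finset.sum_nonneg fun k _ => hrAbsLevelSumAB_nonneg a b Δ ℓ k
  have hbase : ∀ k : ℕ, k ≤ N₁ → hrAbsLevelSumAB a b Δ ℓ k ≤ C * ascWeight K k := fun k hk =>
    calc hrAbsLevelSumAB a b Δ ℓ k ≤ C :=
          Finset.single_le_sum (f := fun k => hrAbsLevelSumAB a b Δ ℓ k)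
            (fun k _ => hrAbsLevelSumAB_nonneg a b Δ ℓ k) (mem_range.mpr (Nat.lt_succ_of_le hk))
      _ = C * 1 := (mul_one C).symm
      _ ≤ C * ascWeight K k := mul_le_mul_of_nonneg_left (one_le_ascWeight K k) hC0
  have main : ∀ k : ℕ, hrAbsLevelSumAB a b Δ ℓ (N₁ + k) ≤ C * ascWeight K (N₁ + k) := by
    intro k
    induction k with
    | zero => exact hbase _ le_rfl
    | succ k ih =>
      have hq : 0 ≤ 1 + (K : ℝ) / (((N₁ + k : ℕ) : ℝ) + 1) := by positivity
      have hstep : 1 + (40 * c + 24) / (((N₁ + k : ℕ) : ℝ) + 1) ≤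
          1 + (K : ℝ) / (((N₁ + k : ℕ) : ℝ) + 1) := by
        have hpos : (0 : ℝ) < ((N₁ + k : ℕ) : ℝ) + 1 := by positivity
        have := div_le_div_of_nonneg_right hKc hpos.le
        linarith
      calc hrAbsLevelSumAB a b Δ ℓ (N₁ + (k + 1)) = hrAbsLevelSumAB a b Δ ℓ (N₁ + k + 1) := by
            rw [Nat.add_assoc]
        _ ≤ (1 + (40 * c + 24) / (((N₁ + k : ℕ) : ℝ) + 1)) * hrAbsLevelSumAB a b Δ ℓ (N₁ + k) :=
            hrAbsLevelSumAB_succ_le hΔ ha hb (hthr _ (Nat.le_add_right _ _))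
        _ ≤ (1 + (K : ℝ) / (((N₁ + k : ℕ) : ℝ) + 1)) * (C * ascWeight K (N₁ + k)) :=
            mul_le_mul hstep ih (hrAbsLevelSumAB_nonneg a b Δ ℓ _) hq
        _ = C * ascWeight K (N₁ + k + 1) := by
            rw [← ascWeight_succ K (N₁ + k)]; push_cast; ring
        _ = C * ascWeight K (N₁ + (k + 1)) := by rw [Nat.add_assoc]
  refine ⟨K, C, hC0, fun n => ?_⟩
  rcases le_or_gt n N₁ with hn | hn
  · exact hbase n hn
  · obtain ⟨k, rfl⟩ := Nat.exists_eq_add_of_le hn.le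
    exact main k

/-! ### 7. Absolute convergence of the `(a,b)` double series on the unit bidisk -/

/-- `λ_i ≤ 1`. [folklore] -/
theorem legendreLam_le_one (i : ℕ) : legendreLam i ≤ 1 := by
  induction i with
  | zero => simp
  | succ i ih =>
    rw [legendreLam_succ]
    have hpos := legendreLam_pos i
    have h2 : (0 : ℝ) < 2 * (i : ℝ) + 2 := by positivity
    rw [div_le_one h2]
    nlinarith

/-- `0 ≤ e_{N,j}(p) ≤ 1`. [folklore] -/
theorem legendreArrDeg_le_one (N j : ℕ) (p : ℕ × ℕ) : legendreArrDeg N j p ≤ 1 := by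
  unfold legendreArrDeg
  split_ifs
  · simp only [legendreArr]
    split_ifs
    · exact mul_le_one₀ (legendreLam_le_one _) (legendreLam_pos _).le (legendreLam_le_one _)
    · exact zero_le_one
  · exact zero_le_one

/-- **Coefficient bound**: `|k^{ab}_{mn}| ≤ b_{m+n-ℓ}(a,b)/λ_ℓ` (and `0` below degree `ℓ`).
[cite: DolanOsborn2004, §3 eqs. (3.10)–(3.11)] -/
theorem abs_hrMonomialCoeffAB_le (a b Δ : ℝ) (ℓ : ℕ) (p : ℕ × ℕ) (hℓ : ℓ ≤ p.1 + p.2) :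
    |hrMonomialCoeffAB a b Δ ℓ p| ≤ hrAbsLevelSumAB a b Δ ℓ (p.1 + p.2 - ℓ) / legendreLam ℓ := by
  have hlam := legendreLam_pos ℓ
  rw [hrMonomialCoeffAB_eq_slice a b Δ ℓ rfl hℓ]
  unfold hrSliceAB hrAbsLevelSumAB
  have hN : ℓ + (p.1 + p.2 - ℓ) + 1 = p.1 + p.2 + 1 := by omega
  rw [hN, Finset.sum_div]
  refine (Finset.abs_sum_le_sum_abs _ _).trans (Finset.sum_le_sum fun j _ => ?_)
  rw [abs_mul, abs_div, abs_of_pos hlam, abs_of_nonneg (legendreArrDeg_nonneg _ _ _)]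
  calc |hrCoeffAB a b Δ ℓ (p.1 + p.2 - ℓ) j| / legendreLam ℓ * legendreArrDeg (p.1 + p.2) j p
      ≤ |hrCoeffAB a b Δ ℓ (p.1 + p.2 - ℓ) j| / legendreLam ℓ * 1 :=
        mul_le_mul_of_nonneg_left (legendreArrDeg_le_one _ _ _) (by positivity)
    _ = |hrCoeffAB a b Δ ℓ (p.1 + p.2 - ℓ) j| / legendreLam ℓ := mul_one _

/-- **Absolute convergence on the bidisk, radial form** for the `(a,b)` array: for `0 ≤ t < 1` the
family `|k^{ab}_{mn}| t^{m+n}` is summable over `ℕ × ℕ`. [cite: DolanOsborn2004, §3 eqs. (3.10)–(3.12)] -/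
theorem summable_abs_hrMonomialCoeffAB_mul_pow {a b Δ : ℝ} {ℓ : ℕ} (hΔ : unitarityBound3D ℓ < Δ)
    {t : ℝ} (ht0 : 0 ≤ t) (ht1 : t < 1) :
    Summable fun p : ℕ × ℕ => |hrMonomialCoeffAB a b Δ ℓ p| * t ^ (p.1 + p.2) := by
  obtain ⟨K, C, hC0, hC⟩ := hrAbsLevelSumAB_le_ascWeight (a := a) (b := b) hΔ
  have hlam := legendreLam_pos ℓ
  have hg := summable_ascWeight_mul_pow K ht0 ht1
  have hprod : Summable fun x : ℕ × ℕ =>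
      (ascWeight K x.1 * t ^ x.1) * (ascWeight K x.2 * t ^ x.2) :=
    hg.mul_of_nonneg hg (fun m => mul_nonneg (ascWeight_pos K m).le (pow_nonneg ht0 _))
      (fun m => mul_nonneg (ascWeight_pos K m).le (pow_nonneg ht0 _))
  refine Summable.of_nonneg_of_le (fun p => mul_nonneg (abs_nonneg _) (pow_nonneg ht0 _))
    (fun p => ?_) (hprod.mul_left (C / legendreLam ℓ))
  have hk : |hrMonomialCoeffAB a b Δ ℓ p| ≤ C / legendreLam ℓ * (ascWeight K p.1 * ascWeight K p.2) := by
    rcases Nat.lt_or_ge (p.1 + p.2) ℓ with hN | hN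
    · rw [hrMonomialCoeffAB_eq_zero_of_lt a b Δ ℓ hN, abs_zero]
      exact mul_nonneg (div_nonneg hC0 hlam.le)
        (mul_nonneg (ascWeight_pos _ _).le (ascWeight_pos _ _).le)
    · refine (abs_hrMonomialCoeffAB_le a b Δ ℓ p hN).trans ?_
      have hle : hrAbsLevelSumAB a b Δ ℓ (p.1 + p.2 - ℓ) ≤ C * (ascWeight K p.1 * ascWeight K p.2) :=
        calc hrAbsLevelSumAB a b Δ ℓ (p.1 + p.2 - ℓ) ≤ C * ascWeight K (p.1 + p.2 - ℓ) := hC _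
          _ ≤ C * ascWeight K (p.1 + p.2) :=
              mul_le_mul_of_nonneg_left (ascWeight_mono K (by omega)) hC0
          _ ≤ C * (ascWeight K p.1 * ascWeight K p.2) :=
              mul_le_mul_of_nonneg_left (ascWeight_add_le K _ _) hC0
      calc hrAbsLevelSumAB a b Δ ℓ (p.1 + p.2 - ℓ) / legendreLam ℓ
          ≤ C * (ascWeight K p.1 * ascWeight K p.2) / legendreLam ℓ :=
            div_le_div_of_nonneg_right hle hlam.le
        _ = C / legendreLam ℓ * (ascWeight K p.1 * ascWeight K p.2) := by ring
  calc |hrMonomialCoeffAB a b Δ ℓ p| * t ^ (p.1 + p.2)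
      ≤ (C / legendreLam ℓ * (ascWeight K p.1 * ascWeight K p.2)) * t ^ (p.1 + p.2) :=
        mul_le_mul_of_nonneg_right hk (pow_nonneg ht0 _)
    _ = C / legendreLam ℓ * ((ascWeight K p.1 * t ^ p.1) * (ascWeight K p.2 * t ^ p.2)) := by
        rw [pow_add]; ring

/-! ### 8. The block for unequal external dimensions -/

/-- The Dolan–Osborn double power series `K^{ab}_{Δ,ℓ}(z,z̄) = Σ k^{ab}_{mn} z^m z̄^n`,
`k^{ab} = hrMonomialCoeffAB a b Δ ℓ`. [cite: DolanOsborn2004, §3 eqs. (3.10)–(3.11)] -/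
noncomputable def hrSeriesAB (a b Δ : ℝ) (ℓ : ℕ) (z zb : ℝ) : ℝ :=
  ∑' p : ℕ × ℕ, hrMonomialCoeffAB a b Δ ℓ p * z ^ p.1 * zb ^ p.2

/-- **The 3D block `g^{Δ₁₂,Δ₃₄}_{Δ,ℓ}` on the square** as the sum of the Dolan–Osborn `z`-series:
`(z z̄)^{(Δ-ℓ)/2} K^{ab}_{Δ,ℓ}(z,z̄)` with `a = -Δ₁₂/2`, `b = Δ₃₄/2`, normalisation `k_{ℓ0} = 1`.
[cite: DolanOsborn2004, §3 eqs. (3.10)–(3.11)] -/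
noncomputable def hrBlockAB (Δ₁₂ Δ₃₄ Δ : ℝ) (ℓ : ℕ) (z zb : ℝ) : ℝ :=
  (z * zb) ^ ((Δ - (ℓ : ℝ)) / 2) * hrSeriesAB (-Δ₁₂ / 2) (Δ₃₄ / 2) Δ ℓ z zb

/-- At `Δ₁₂ = Δ₃₄ = 0` this is the block of `BlockExistence`. [cite: DolanOsborn2004, §3 eq. (3.11)] -/
theorem hrBlockAB_zero_zero (Δ : ℝ) (ℓ : ℕ) : hrBlockAB 0 0 Δ ℓ = hrBlock Δ ℓ := by
  funext z zb
  unfold hrBlockAB hrBlock hrSeriesAB hrSeries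
  rw [neg_zero, zero_div, hrMonomialCoeffAB_zero_zero]

/-- The typed clause `IsDoublePowerSeriesOn` for the `(a,b)` array. [cite: DolanOsborn2004, §3 eqs. (3.10)–(3.12)] -/
theorem isDoublePowerSeriesOn_hrSeriesAB {a b Δ : ℝ} {ℓ : ℕ} (hΔ : unitarityBound3D ℓ < Δ) :
    IsDoublePowerSeriesOn (hrMonomialCoeffAB a b Δ ℓ) (hrSeriesAB a b Δ ℓ) := by
  intro z zb hz hzb
  refine ⟨?_, rfl⟩
  set t := max |z| |zb| with ht
  have ht0 : 0 ≤ t := le_max_of_le_left (abs_nonneg z)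
  have ht1 : t < 1 := max_lt hz hzb
  refine Summable.of_nonneg_of_le (fun p => by positivity) (fun p => ?_)
    (summable_abs_hrMonomialCoeffAB_mul_pow (a := a) (b := b) hΔ ht0 ht1)
  rw [pow_add, mul_assoc]
  exact mul_le_mul_of_nonneg_left (mul_le_mul (pow_le_pow_left₀ (abs_nonneg z) (le_max_left _ _) _)
    (pow_le_pow_left₀ (abs_nonneg zb) (le_max_right _ _) _) (pow_nonneg (abs_nonneg zb) _)
    (pow_nonneg ht0 _)) (abs_nonneg _)

/-- **Existence of the generic block for ALL external dimensions.** For every `Δ` strictly above the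
3D unitarity bound and every `Δ₁₂, Δ₃₄`, `hrBlockAB Δ₁₂ Δ₃₄ Δ ℓ` satisfies
`IsConformalBlock3DAbove Δ₁₂ Δ₃₄ Δ ℓ` (symmetric absolutely convergent double power series with the
Dolan–Osborn boundary row, solving the Casimir equation on `(0,1)²`).
[cite: DolanOsborn2004, §3 eqs. (3.9)–(3.12)] -/
theorem isConformalBlock3DAbove_hrBlockAB {Δ₁₂ Δ₃₄ Δ : ℝ} {ℓ : ℕ} (hΔ : unitarityBound3D ℓ < Δ) :
    IsConformalBlock3DAbove Δ₁₂ Δ₃₄ Δ ℓ (hrBlockAB Δ₁₂ Δ₃₄ Δ ℓ) :=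
  ⟨hrMonomialCoeffAB (-Δ₁₂ / 2) (Δ₃₄ / 2) Δ ℓ, hrSeriesAB (-Δ₁₂ / 2) (Δ₃₄ / 2) Δ ℓ,
    isDoublePowerSeriesOn_hrSeriesAB hΔ, hrMonomialCoeffAB_symm _ _ Δ ℓ,
    hrMonomialCoeffAB_hasLeadingPart _ _ Δ ℓ, fun _ _ _ _ => rfl,
    casimirEq3D_of_satisfiesCoeffCasimir (isDoublePowerSeriesOn_hrSeriesAB hΔ)
      (fun _ _ _ _ => rfl) (hrMonomialCoeffAB_satisfies _ _ hΔ)⟩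

/-- **Existence of the genuine block at regular points, all external dimensions** — satisfiability of
the typed clause A2 for the `σε` channels as well. [cite: DolanOsborn2004, §3 eqs. (3.9)–(3.12)] -/
theorem isConformalBlock3D_hrBlockAB {Δ₁₂ Δ₃₄ Δ : ℝ} {ℓ : ℕ} (hΔ : unitarityBound3D ℓ < Δ)
    (hreg : ¬ accidentalDegeneracy3D Δ ℓ) :
    IsConformalBlock3D Δ₁₂ Δ₃₄ Δ ℓ (hrBlockAB Δ₁₂ Δ₃₄ Δ ℓ) :=
  Or.inl ⟨⟨hΔ.ne', hreg⟩, isConformalBlock3DAbove_hrBlockAB hΔ⟩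

/-- Satisfiability of A2 at regular points for every `(Δ₁₂, Δ₃₄)`. [cite: DolanOsborn2004, §3 eqs. (3.9)–(3.12)] -/
theorem exists_isConformalBlock3D_ab (Δ₁₂ Δ₃₄ : ℝ) {Δ : ℝ} {ℓ : ℕ} (hΔ : unitarityBound3D ℓ < Δ)
    (hreg : ¬ accidentalDegeneracy3D Δ ℓ) : ∃ g : ℝ → ℝ → ℝ, IsConformalBlock3D Δ₁₂ Δ₃₄ Δ ℓ g :=
  ⟨hrBlockAB Δ₁₂ Δ₃₄ Δ ℓ, isConformalBlock3D_hrBlockAB hΔ hreg⟩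

/-- **Existence and uniqueness, all external dimensions**: at a regular point any function satisfying
`IsConformalBlock3DAbove Δ₁₂ Δ₃₄ Δ ℓ` equals `hrBlockAB Δ₁₂ Δ₃₄ Δ ℓ` on the open square.
[cite: DolanOsborn2004, §3 eqs. (3.9)–(3.12)] -/
theorem IsConformalBlock3DAbove.eq_hrBlockAB {Δ₁₂ Δ₃₄ Δ : ℝ} {ℓ : ℕ} {g : ℝ → ℝ → ℝ}
    (hΔ : unitarityBound3D ℓ < Δ) (hreg : ¬ accidentalDegeneracy3D Δ ℓ)
    (h : IsConformalBlock3DAbove Δ₁₂ Δ₃₄ Δ ℓ g) :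
    ∀ z zb : ℝ, z ∈ Ioo (0 : ℝ) 1 → zb ∈ Ioo (0 : ℝ) 1 → g z zb = hrBlockAB Δ₁₂ Δ₃₄ Δ ℓ z zb :=
  h.eqOn_of_isRegular hΔ hreg (isConformalBlock3DAbove_hrBlockAB hΔ)

end Literature.MathematicalPhysics.QuantumFieldTheory.ConformalBootstrap3D
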